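import Literature.AlgebraicGeometry.HodgeTheory.TopDegreeClasses
import Literature.AlgebraicGeometry.HodgeTheory.HodgeModelExistenceProofs
import Literature.AlgebraicGeometry.Motives.ClosedGraphMorphism
import Literature.AlgebraicGeometry.Motives.FiniteFlatDegreeProofs
import Literature.AlgebraicGeometry.Motives.ChowZeroSupportedOnHyperplaneSection
import Literature.AlgebraicGeometry.Motives.VarietiesProperProofs
import Literature.NumberTheory.Transcendental.AnalytificationClosure
import Literature.NumberTheory.Transcendental.AnalytificationSeparatedProofs
import HarnessLib

/-!
# A finite map injective over `φ(c)` on `Z` and locally injective at `c` does not fold `Z` at `c`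

The set-theoretic half of "`Z` appears with multiplicity one in `φ⁻¹(φ Z)`" (Fulton, *Intersection
Theory*, Example 11.4.1 (a): for a generic projection the residual cycle `γ_L` of
`π_L^*[C_L] = [Z] + γ_L` does not contain `Z`; Voisin, *Hodge Theory II*, §9.2.4, proof of Lemma 9.22),
in the analytic form used by the avoidance proof of Roberts' generic projection lemma
(`Motives/GenericProjectionCone`, plan `Summits/HodgeConjecture/…/Cruxes/HodgeBeyondAnchors/ROBERTS-PLAN.md` §3):

* `pt_notMem_closure_preimage_image_diff` — for a FINITE morphism `φ : X ⟶ Y` of smooth projective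
  complex varieties, a closed `Z ⊆ X` and a complex point `c` of `Z` such that `φ(ℂ)` is injective on
  `Z(ℂ)` over `φ(c)` (no other complex point of `Z` maps to `φ(c)`) and `φ(ℂ)` agrees near `c` with an
  open partial homeomorphism (e.g. `φ` étale at `c`, `Motives/ComplexPointsEtaleLocalHomeomorph`,
  `…UnramifiedLocalHomeomorph`), the point `c` is NOT in the Zariski closure of `φ⁻¹(φ Z) ∖ Z`; i.e.
  `Z' := closure (φ⁻¹(φ Z) ∖ Z)`, the union of the components of `φ⁻¹(φ Z)` other than those inside
  `Z`, misses `c`.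

Proof (topology of complex points): `Z'(ℂ)` is the closure of `(φ⁻¹(φ Z) ∖ Z)(ℂ)` (SGA1 XII 2.2,
`ComplexPoints.preimage_pt_closure_eq`, the set being constructible); `K := Z(ℂ)` is compact
(`compactSpace_complexPoints_of_isSmoothProjective`), so `φ(K ∖ U)` is closed for the chart domain
`U ∋ c` and misses `φ(c)` by injectivity over `φ(c)`; a complex point `P ∉ Z` of `φ⁻¹(φ Z)` close to `c`
inside `U ∖ φ⁻¹ φ(K ∖ U)` has `φ(P) = φ(Q)` for a complex point `Q` of `Z` (points of a finite fibre
over a closed point are closed: `height_base_eq_of_isFinite`, `isClosed_singleton_of_height_eq_zero`,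
`AlgPoints.exists_pt_eq_of_isClosed_singleton`), necessarily `Q ∈ U`, and then `P = Q ∈ Z` by
injectivity of the chart — contradiction. Everything is proved; no named facts.

## References
* [Fulton1998] W. Fulton, Intersection Theory, 2nd ed. 1998, §11.4 Example 11.4.1 (a).
* [VoisinHodgeII2003] C. Voisin, Hodge Theory and Complex Algebraic Geometry II, §9.2.4, proof of Lemma 9.22.
* [SGA1] A. Grothendieck, M. Raynaud, SGA 1, Exp. XII Prop. 2.2, Prop. 3.1.

#harness_tags algebraic_geometry.finite_morphisms, algebraic_geometry.gaga
-/

noncomputable section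

open CategoryTheory AlgebraicGeometry Set Order Topology TopologicalSpace
open Literature.AlgebraicGeometry.HodgeTheory

namespace Literature.AlgebraicGeometry.Motives

/-- **A finite map injective over `φ(c)` on `Z(ℂ)` and locally injective at `c` does not fold `Z`
at `c`**: `c ∉ closure (φ⁻¹(φ Z) ∖ Z)` (Zariski closure in `X`). The set-theoretic content of
"`Z` has multiplicity one in `φ⁻¹(φ Z)` at `c`" (Fulton Ex. 11.4.1 (a); Voisin II, proof of
Lemma 9.22), read on complex points. [folklore] -/
theorem pt_notMem_closure_preimage_image_diff {n : ℕ} {X Y : SchemeOver ℂ}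
    (hX : IsSmoothProjective n X) (hY : IsSmoothProjective n Y) (φ : X ⟶ Y) [IsFinite φ.left]
    {Z : Set X.left} (hZ : IsClosed Z) {c : ComplexPoints X}
    (hinj : ∀ P : ComplexPoints X, P.pt ∈ Z → AlgPoints.map φ P = AlgPoints.map φ c → P = c)
    (e : OpenPartialHomeomorph (ComplexPoints X) (ComplexPoints Y)) (hce : c ∈ e.source)
    (hφe : Set.EqOn (AlgPoints.map φ) e e.source) :
    c.pt ∉ closure (φ.left.base ⁻¹' (φ.left.base '' Z) \ Z) := by
  classical
  -- instances
  haveI := hX.smoothOfRelativeDimension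
  haveI := hY.smoothOfRelativeDimension
  haveI : LocallyOfFiniteType X.hom := by
    haveI : Smooth X.hom := SmoothOfRelativeDimension.smooth n _
    infer_instance
  haveI : LocallyOfFiniteType Y.hom := by
    haveI : Smooth Y.hom := SmoothOfRelativeDimension.smooth n _
    infer_instance
  haveI := IsSmoothProjective.isLocallyNoetherian_holds hX
  haveI := IsSmoothProjective.compactSpace_holds hX
  haveI : IsNoetherian X.left := {}
  haveI : NoetherianSpace ↥X.left := inferInstance
  haveI : CompactSpace (ComplexPoints X) := compactSpace_complexPoints_of_isSmoothProjective hX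
  haveI : IsProper Y.hom := IsSmoothProjective.isProper_holds hY
  haveI : T2Space (ComplexPoints Y) := ComplexPoints.t2Space_of_isSeparated Y
  -- the residual set `D = φ⁻¹(φ Z) ∖ Z` is constructible
  set C : Set X.left := φ.left.base ⁻¹' (φ.left.base '' Z) with hCdef
  have hCc : IsClosed C := (φ.left.isClosedMap Z hZ).preimage φ.left.continuous
  have hret : ∀ U : Set X.left, IsOpen U → IsRetrocompact U :=
    fun U _ V _ _ ↦ NoetherianSpace.isCompact _
  have hD : Topology.IsLocallyConstructible (C \ Z) := by
    rw [Set.sdiff_eq]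
    refine (Topology.IsConstructible.inter ?_ ?_).isLocallyConstructible
    · rw [← compl_compl C]
      exact (IsRetrocompact.isConstructible hCc.isOpen_compl (hret _ hCc.isOpen_compl)).compl
    · exact IsRetrocompact.isConstructible hZ.isOpen_compl (hret _ hZ.isOpen_compl)
  intro hmem
  have hcl := ComplexPoints.preimage_pt_closure_eq X hD
  have hcS : c ∈ closure (AlgPoints.pt ⁻¹' (C \ Z) : Set (ComplexPoints X)) := by
    rw [← hcl]
    exact hmem
  -- `K = Z(ℂ)` is closed, `K ∖ U` compact, its image closed and missing `φ(c)`
  set Φ : ComplexPoints X → ComplexPoints Y := AlgPoints.map (L := ℂ) φ with hΦdef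
  have hΦc : Continuous Φ := AlgPoints.continuous_map φ
  set K : Set (ComplexPoints X) := {P | P.pt ∈ Z} with hKdef
  have hKc : IsClosed K := ⟨AlgPoints.isOpen_setOf_pt_mem (X := X) (L := ℂ) ⟨Zᶜ, hZ.isOpen_compl⟩⟩
  have hK'cpt : IsCompact (K ∩ e.sourceᶜ) := (hKc.inter e.open_source.isClosed_compl).isCompact
  have hFc : IsClosed (Φ '' (K ∩ e.sourceᶜ)) := (hK'cpt.image hΦc).isClosed
  have hcF : Φ c ∉ Φ '' (K ∩ e.sourceᶜ) := by
    rintro ⟨Q, ⟨hQK, hQU⟩, hQc⟩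
    have hQeq : Q = c := hinj Q hQK hQc
    exact hQU (hQeq ▸ hce)
  -- a residual complex point `P` near `c`, inside the good neighbourhood `V`
  set V : Set (ComplexPoints X) := e.source ∩ Φ ⁻¹' (Φ '' (K ∩ e.sourceᶜ))ᶜ with hVdef
  have hV : IsOpen V := e.open_source.inter (hFc.isOpen_compl.preimage hΦc)
  have hcV : c ∈ V := ⟨hce, hcF⟩
  obtain ⟨P, hPV, hPC, hPZ⟩ := mem_closure_iff.1 hcS V hV hcV
  obtain ⟨z, hz, hzP⟩ := hPC
  -- the point `z ∈ Z` over `φ(P)` is closed, hence a complex point `Q` of `Z` with `φ(Q) = φ(P)`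
  have hzcl : IsClosed ({z} : Set X.left) := by
    apply isClosed_singleton_of_height_eq_zero
    have h1 : height (φ.left.base z) = height z := height_base_eq_of_isFinite φ.left z
    rw [← h1, hzP]
    exact height_pt_eq_zero (AlgPoints.map φ P)
  obtain ⟨Q, hQ⟩ := AlgPoints.exists_pt_eq_of_isClosed_singleton (X := X) (K := ℂ) hzcl
  have hQK : Q ∈ K := by
    change Q.pt ∈ Z
    rw [hQ]
    exact hz
  have hΦQ : Φ Q = Φ P := by
    apply AlgPoints.eq_of_pt_eq
    change φ.left.base Q.pt = φ.left.base P.pt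
    rw [hQ, hzP]
  -- `Q` lies in the chart domain (else `φ(P) = φ(Q)` would be a bad value), so `Q = P` by injectivity
  have hQU : Q ∈ e.source := by
    by_contra hQU
    exact hPV.2 ⟨Q, ⟨hQK, hQU⟩, hΦQ⟩
  have hQP : Q = P := by
    refine e.injOn hQU hPV.1 ?_
    rw [← hφe hQU, ← hφe hPV.1]
    exact hΦQ
  exact hPZ (hQP ▸ hQK)

end Literature.AlgebraicGeometry.Motives

end
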